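import Summits.HodgeConjecture.HodgeConjecture.Theorems.HeckePrymWeilHeckePrymAnchorsOfTwoFacts
import Literature.AlgebraicGeometry.HodgeTheory.InvariantClassesFromTotalSpaceHolds
import Literature.AlgebraicGeometry.HodgeTheory.WeilFamilyLevelStructure
import HarnessLib

/-!
# `HeckePrymAnchors` from a Weil family with an ALGEBRAIC anchor fibre (item stmt-HodgeConjecture-14496, route HeckePrymWeil)

Line `Sketch`, continuation lead c34. The landed closures of this line
(`heckePrymAnchors_of_sections` → `…_of_two_facts` → `…_of_kAction` → `…_of_deligneWeilFamilyDecl`)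
consume Deligne's Weil family through `X` in the shape of the named facts
`deligne1982_weilFamily_kAction / _globalAction / _hodgeWeilSection`, whose clause at the special
point `s₀` is the TENSOR-SPLIT fibre: an isogeny pair between `(Y, Ψ) ≅ 𝒳_{s₀}` and a tensor point
`(A₁ × A₁, (x, y) ↦ (-p·y, x))`. In the reduction of those facts to Deligne's period construction
(`HodgeTheory/WeilFamilyLevelStructureOfPeriodConstruction`) that clause is the ONLY consumer of
Riemann's theorem / fullness [F]. But the crux uses the clause only through
`owf_anchorAlgebraic : … → weilClassesOf Y Ψ k p ≤ algebraicClasses Y.X k` (last line of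
`heckePrymAnchors_of_sections`). This file re-runs the three landed pipeline steps with the
`s₀`-clause REPLACED by that inequality ("the strong Weil plane of the fibre over `s₀` is
algebraic"), giving

* `heckePrymAnchors_of_sections_alg` — W-engine + fibrewise-Hodge Weil section with algebraic
  anchor fibre ⟹ crux (the proof of `heckePrymAnchors_of_sections` verbatim up to its last line);
* `hodgeWeilSectionAlg_of_globalActionAlg`, `globalActionAlg_of_kActionAlg` — the proofs of
  `deligne1982_weilFamily_hodgeWeilSection_of_globalAction` and
  `deligne1982_weilFamily_globalAction_of_kAction` verbatim (they never open the `s₀`-clause);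
* `heckePrymAnchors_of_kActionAlg` — the composition, the W-engine discharged by the tree's theorem
  `deligne1968_invariantClass_fromTotalSpace_holds` exactly as in `heckePrymAnchors_of_globalAction`.

The sequel (`…AlgebraicAnchorOfPeriodConstruction`) derives the algebraic-anchor family from
Deligne's period construction ALONE — at the fibre over the rational diagonal CM point the Weil
classes are cup products of rational `(1,1)`-classes (Lefschetz `(1,1)`, a theorem of the tree) —
so that Riemann's theorem drops out of the residual of this crux. No definition, no `sorry`, no
named fact taken as hypothesis beyond the displayed family package.
-/

noncomputable section

-- every declaration of this problem lives in `Summit.HodgeConjecture.HodgeConjecture.…` (summit = sub-problem)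
set_option linter.dupNamespace false

open CategoryTheory AlgebraicGeometry Limits MonoidalCategory CartesianMonoidalCategory
open Literature.AlgebraicTopology.SingularHomology

namespace Summit.HodgeConjecture.HodgeConjecture.Theorems.HeckePrymWeilLine

open Literature.AlgebraicGeometry Literature.AlgebraicGeometry.Motives Literature.AlgebraicGeometry.HodgeTheory
open Summit.HodgeConjecture.HodgeConjecture.Theses.HeckePrymWeil

/-- **`HeckePrymAnchors` from the W-engine and a Weil family with fibrewise-Hodge Weil section and an
ALGEBRAIC anchor fibre.** As `heckePrymAnchors_of_sections`, with the tensor-split clause at `s₀`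
replaced by what that proof extracts from it: `weilClassesOf Y Ψ k p ≤ algebraicClasses Y.X k` for
the fibre `(Y, Ψ) ≅ 𝒳_{s₀}` in whose strong Weil plane the section's value lies. Proof verbatim
(companion Weil surface `stub_weilSurface`, typing upgrade `stub_upgrade`, W-engine `hG`,
rationality along the section `stub_rationalAlongSection`, Hodge type from the family clause, and
at `s₀` transport of algebraicity along the chart `owf_isoTransport`); `c = 0` by the constant
family `owf_anchored_zero`.
[cite: Deligne1982HodgeCycles, proof of Thm. 4.8 (pp. 47–52) with Prop. 4.4]
[cite: VoisinHodgeII2003, Thm. 4.18] [cite: vanGeemen1994HodgeAV, §5.3–5.11] -/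
theorem heckePrymAnchors_of_sections_alg :
    (∀ ⦃𝒳 S : SchemeOver ℂ⦄ (f : 𝒳 ⟶ S) (n k : ℕ), IsSmoothProjectiveFamily f n → (∃ (N : ℕ) (ι : 𝒳 ⟶ projectiveSpace N ℂ ⊗ S), IsClosedImmersion ι.left ∧ ι ≫ snd (projectiveSpace N ℂ) S = f) → AlgebraicGeometry.Smooth S.hom → IsQuasiProjectiveOver S → IrreducibleSpace S.left → ∀ (σ : ComplexPoints S → FiberClass f k), Continuous σ → (∀ s, (σ s).pt = s) → ∃ W : complexBetti 𝒳 k, ∀ s, σ s = globalSection f k W s) →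
    (∀ p : ℕ, p.Prime → p % 4 = 3 → 7 ≤ p → ∀ (k : ℕ), 1 ≤ k → ∀ (X : AbelianVariety ℂ) (Φ : X ⟶ X), X.dim = 2 * k → Φ ≫ Φ = -((p : ℤ) • 𝟙 X) → ∀ c : complexBetti X.X (2 * k), c ∈ weilClassesOf X Φ k p → c ≠ 0 → IsRationalClass c → IsOfHodgeType (2 * k) X.X (2 * k) k k c → ∃ (𝒳 S : SchemeOver ℂ) (f : 𝒳 ⟶ S) (s₁ s₀ : ComplexPoints S) (e : X.X ≅ fiberOver f s₁) (σ : ComplexPoints S → FiberClass f (2 * k)), IsSmoothProjectiveFamily f (2 * k) ∧ (∃ (N : ℕ) (ι : 𝒳 ⟶ projectiveSpace N ℂ ⊗ S), IsClosedImmersion ι.left ∧ ι ≫ snd (projectiveSpace N ℂ) S = f) ∧ IrreducibleSpace S.left ∧ AlgebraicGeometry.Smooth S.hom ∧ IsQuasiProjectiveOver S ∧ (∀ s : ComplexPoints S, ∃ (A' : AbelianVariety ℂ) (φ' : A' ⟶ A'), A'.dim = 2 * k ∧ φ' ≫ φ' = -((p : ℤ) • 𝟙 A') ∧ Nonempty (A'.X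 ≅ fiberOver f s)) ∧ Continuous σ ∧ (∀ s, (σ s).pt = s) ∧ (∀ s, IsOfHodgeType (2 * k) (fiberOver f (σ s).pt) (2 * k) k k (σ s).cls) ∧ σ s₁ = ⟨s₁, complexBetti.map e.inv (2 * k) c⟩ ∧ ∃ (Y : AbelianVariety ℂ) (Ψ : Y ⟶ Y) (e₀ : Y.X ≅ fiberOver f s₀) (x : complexBetti (fiberOver f s₀) (2 * k)), weilClassesOf Y Ψ k p ≤ algebraicClasses Y.X k ∧ σ s₀ = ⟨s₀, x⟩ ∧ complexBetti.map e₀.hom (2 * k) x ∈ weilClassesOf Y Ψ k p) →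
    Summit.HodgeConjecture.HodgeConjecture.Theses.HeckePrymWeil.HeckePrymAnchors := by
  intro hG hWF p hp hp4 hp7 g hg n k hk hkm A φ hA hφ
  obtain ⟨B, ψ, hBW⟩ := stub_weilSurface p hp hp4 hp7
  refine ⟨B, ψ, hBW.1, hBW.2.1, hBW.2.2, ?_⟩
  intro c hrat hH hW
  have hk1 : 1 ≤ k := by have := owf_three_le_k hp7 hg hkm; omega
  -- the product `X = A × B` with `Φ = φ × ψ`
  have hX : (A.prod B).dim = 2 * k := by
    rw [AbelianVariety.dim_prod, hA, hBW.1]; omega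
  have hφ' : φ ≫ φ = -(p • 𝟙 A) := by rw [hφ, natCast_zsmul]
  have hψ' : ψ ≫ ψ = -(p • 𝟙 B) := by rw [hBW.2.1, natCast_zsmul]
  have hΦ : AbelianVariety.prodLift (AbelianVariety.fst A B ≫ φ) (AbelianVariety.snd A B ≫ ψ) ≫
      AbelianVariety.prodLift (AbelianVariety.fst A B ≫ φ) (AbelianVariety.snd A B ≫ ψ) =
      -((p : ℤ) • 𝟙 (A.prod B)) := by
    rw [prodLift_comp_self_eq_neg_nsmul hφ' hψ', natCast_zsmul]
  -- the zero class: constant family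
  by_cases h0 : c = 0
  · subst h0
    exact owf_anchored_zero p k (A.prod B) _ hX hΦ ⟨hH.choose⟩
  -- typing upgrade, then the Weil family with its flat, fibrewise Hodge, Weil section
  have hcW := stub_upgrade p hp hp4 hp7 k (A.prod B) _ hX hΦ hW
  obtain ⟨𝒳, S, f, s₁, s₀, e, σ, hfam, hι, hirr, hsm, hSqp, hfib, hσ, hpt, hHσ, hs₁, Y, Ψ, e₀, x,
    hWalg, hs₀, hx⟩ :=
    hWF p hp hp4 hp7 k hk1 (A.prod B) _ hX hΦ c hcW h0 hrat hH
  -- the global class of the section (W-engine)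
  obtain ⟨W, hWσ⟩ := hG f (2 * k) (2 * k) hfam hι hsm hSqp hirr σ hσ hpt
  have hcls : ∀ (s : ComplexPoints S) (y : complexBetti (fiberOver f s) (2 * k)),
      σ s = ⟨s, y⟩ → complexBetti.map (fiberι f s) (2 * k) W = y := by
    intro s y hy
    have h := (hWσ s).symm.trans hy
    simp only [globalSection, FiberClass.mk.injEq, heq_eq_eq, true_and] at h
    exact h
  have hW₁ : complexBetti.map (fiberι f s₁) (2 * k) W = complexBetti.map e.inv (2 * k) c :=
    hcls s₁ _ hs₁
  have hW₀ : complexBetti.map (fiberι f s₀) (2 * k) W = x := hcls s₀ x hs₀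
  -- rationality along the section (proved), Hodge type from the family's clause (a)
  have hrat₁ : IsRationalClass (σ s₁).cls := by
    rw [hs₁]; exact hrat.map _
  have hratσ : ∀ s, IsRationalClass (σ s).cls :=
    stub_rationalAlongSection f (2 * k) (2 * k) hfam hsm hSqp hirr σ hσ hpt s₁ hrat₁
  have hfibre : ∀ s : ComplexPoints S, IsRationalClass (complexBetti.map (fiberι f s) (2 * k) W) ∧
      IsOfHodgeType (2 * k) (fiberOver f s) (2 * k) k k (complexBetti.map (fiberι f s) (2 * k) W) := by
    intro s
    have h₁ := hratσ s
    have h₂ := hHσ s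
    rw [hWσ s] at h₁ h₂
    exact ⟨h₁, h₂⟩
  -- assemble the anchoring
  refine ⟨𝒳, S, f, s₁, s₀, e, W, hfam, hirr, hsm, hfibre, hfib, ?_, ?_⟩
  · rw [hW₁, ← CategoryTheory.comp_apply, ← complexBetti.map_comp, Iso.hom_inv_id, complexBetti.map_id]
    rfl
  · rw [hW₀]
    exact owf_isoTransport _ Y e₀ k x (hWalg hx)

/-- **The abelian scheme with `K`-action (algebraic-anchor form) gives the fibrewise-Hodge flat Weil
section (algebraic-anchor form)** — the proof of
`deligne1982_weilFamily_hodgeWeilSection_of_globalAction` verbatim: transport along paths from `s₁`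
preserves the cohomological Weil planes of the fibres, which the charts of clause (a) identify with
the Weil planes of balanced abelian `2k`-folds; the `s₀`-clause (here: the strong Weil plane of the
fibre `(Y, Ψ)` is algebraic) is carried along unopened.
[cite: Deligne1982HodgeCycles, proof of Thm. 4.8 (pp. 48–51) with Prop. 4.4]
[cite: VoisinHodgeII2003, §3.1.2] -/
theorem hodgeWeilSectionAlg_of_globalActionAlg :
    (∀ p : ℕ, p.Prime → p % 4 = 3 → 7 ≤ p → ∀ (k : ℕ), 1 ≤ k → ∀ (X : AbelianVariety ℂ) (Φ : X ⟶ X), X.dim = 2 * k → Φ ≫ Φ = -((p : ℤ) • 𝟙 X) → ∀ c : complexBetti X.X (2 * k), c ∈ weilClassesOf X Φ k p → c ≠ 0 → IsRationalClass c → IsOfHodgeType (2 * k) X.X (2 * k) k k c → ∃ (𝒳 S : SchemeOver ℂ) (f : 𝒳 ⟶ S) (g : 𝒳 ⟶ 𝒳) (s₁ s₀ : ComplexPoints S) (e : X.X ≅ fiberOver f s₁) (σ : ComplexPoints S → FiberClass f (2 * k)), IsSmoothProjectiveFamily f (2 * k) ∧ (∃ (N : ℕ) (ι : 𝒳 ⟶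 projectiveSpace N ℂ ⊗ S), IsClosedImmersion ι.left ∧ ι ≫ snd (projectiveSpace N ℂ) S = f) ∧ IrreducibleSpace S.left ∧ AlgebraicGeometry.Smooth S.hom ∧ IsQuasiProjectiveOver S ∧ g ≫ f = f ∧ (∀ s : ComplexPoints S, ∃ (A' : AbelianVariety ℂ) (φ' : A' ⟶ A') (e' : A'.X ≅ fiberOver f s), A'.dim = 2 * k ∧ φ' ≫ φ' = -((p : ℤ) • 𝟙 A') ∧ (e'.hom ≫ fiberι f s) ≫ g = φ'.hom.hom.hom ≫ (e'.hom ≫ fiberι f s) ∧ ∀ w ∈ weilClassesOf A' φ' k p, IsOfHodgeType (2 * k) A'.X (2 * k) k k w) ∧ (e.hom ≫ fiberι f s₁) ≫ g = Φ.hom.hom.hom ≫ (e.hom ≫ fiberι f s₁) ∧ Continuous σ ∧ (∀ s, (σ s).pt = s) ∧ σ s₁ = ⟨s₁, complexBetti.map e.inv (2 * k) c⟩ ∧ ∃ (Y : AbelianVariety ℂ) (Ψ : Y ⟶ Y) (e₀ : Y.X ≅ fiberOver f s₀), weilClassesOf Y Ψ k p ≤ algebraicClasses Y.X k ∧ (e₀.hom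 ≫ fiberι f s₀) ≫ g = Ψ.hom.hom.hom ≫ (e₀.hom ≫ fiberι f s₀)) →
    (∀ p : ℕ, p.Prime → p % 4 = 3 → 7 ≤ p → ∀ (k : ℕ), 1 ≤ k → ∀ (X : AbelianVariety ℂ) (Φ : X ⟶ X), X.dim = 2 * k → Φ ≫ Φ = -((p : ℤ) • 𝟙 X) → ∀ c : complexBetti X.X (2 * k), c ∈ weilClassesOf X Φ k p → c ≠ 0 → IsRationalClass c → IsOfHodgeType (2 * k) X.X (2 * k) k k c → ∃ (𝒳 S : SchemeOver ℂ) (f : 𝒳 ⟶ S) (s₁ s₀ : ComplexPoints S) (e : X.X ≅ fiberOver f s₁) (σ : ComplexPoints S → FiberClass f (2 * k)), IsSmoothProjectiveFamily f (2 * k) ∧ (∃ (N : ℕ) (ι : 𝒳 ⟶ projectiveSpace N ℂ ⊗ S), IsClosedImmersion ι.left ∧ ι ≫ snd (projectiveSpace N ℂ) S = f) ∧ IrreducibleSpace S.left ∧ AlgebraicGeometry.Smooth S.hom ∧ IsQuasiProjectiveOver S ∧ (∀ s : ComplexPoints S, ∃ (A' : AbelianVariety ℂ) (φ' : A' ⟶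 A'), A'.dim = 2 * k ∧ φ' ≫ φ' = -((p : ℤ) • 𝟙 A') ∧ Nonempty (A'.X ≅ fiberOver f s)) ∧ Continuous σ ∧ (∀ s, (σ s).pt = s) ∧ (∀ s, IsOfHodgeType (2 * k) (fiberOver f (σ s).pt) (2 * k) k k (σ s).cls) ∧ σ s₁ = ⟨s₁, complexBetti.map e.inv (2 * k) c⟩ ∧ ∃ (Y : AbelianVariety ℂ) (Ψ : Y ⟶ Y) (e₀ : Y.X ≅ fiberOver f s₀) (x : complexBetti (fiberOver f s₀) (2 * k)), weilClassesOf Y Ψ k p ≤ algebraicClasses Y.X k ∧ σ s₀ = ⟨s₀, x⟩ ∧ complexBetti.map e₀.hom (2 * k) x ∈ weilClassesOf Y Ψ k p) := by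
  intro h p hp hp4 hp7 k hk X Φ hX hΦ c hc hc0 hrat hH
  obtain ⟨𝒳, S, f, g, s₁, s₀, e, σ, hfam, hemb, hirr, hsm, hSqp, hg, hfib, he, hσ, hpt, hσ₁, Y, Ψ,
    e₀, halg, he₀⟩ := h p hp hp4 hp7 k hk X Φ hX hΦ c hc hc0 hrat hH
  have hp0 : 0 < p := hp.pos
  -- the base: `S(ℂ)` is a path-connected manifold and `R^{2k} f_* ℂ` is a local system on it
  haveI := hsm
  haveI := hirr
  haveI : LocallyOfFiniteType S.hom := hSqp.locallyOfFiniteType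
  haveI : ConnectedSpace (Motives.ComplexPoints S) :=
    (Motives.ComplexPoints.connectedSpace_iff_holds S).2 inferInstance
  obtain ⟨d, hd⟩ := exists_smoothOfRelativeDimension_of_connectedSpace_complexPoints S
  haveI := hd
  haveI := pathConnectedSpace_complexPoints_of_smoothOfRelativeDimension S d
  have hU := isCohomologicallyLocallyTrivialOn_univ_of_isSmoothProjectiveFamily f d hfam hSqp
  -- the fibre maps of `g`
  have hgf' := fun t ↦ exists_fiberHom_comp_fiberι f g hg t
  choose gf hgf using hgf'
  -- the cohomological Weil plane of the fibre over `t`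
  let WP : ∀ t : Motives.ComplexPoints S, Submodule ℂ (complexBetti (Motives.fiberOver f t) (2 * k)) :=
    fun t ↦
      Submodule.span ℂ
        {x | ∃ w : Fin (2 * k) → complexBetti (Motives.fiberOver f t) 1,
          (∀ i, w i ∈ Module.End.eigenspace (complexBetti.map (gf t) 1).hom
            (Complex.I * (Real.sqrt p : ℂ))) ∧
          cupPowOne ℂ (Motives.ComplexPoints (Motives.fiberOver f t)) (2 * k) w = x} ⊔
      Submodule.span ℂ
        {x | ∃ w : Fin (2 * k) → complexBetti (Motives.fiberOver f t) 1,
          (∀ i, w i ∈ Module.End.eigenspace (complexBetti.map (gf t) 1).hom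
            (-(Complex.I * (Real.sqrt p : ℂ)))) ∧
          cupPowOne ℂ (Motives.ComplexPoints (Motives.fiberOver f t)) (2 * k) w = x}
  -- at `s₁`: `e^{-1 *} c` lies in the Weil plane of `(𝒳_{s₁}, g_{s₁})`
  have hΦ' : Φ ≫ Φ = -(p • 𝟙 X) := by rw [hΦ, natCast_zsmul]
  have he' : e.hom ≫ gf s₁ = Φ.hom.hom.hom ≫ e.hom :=
    hom_comp_fiberHom_eq_of_comp_fiberι f g (hgf s₁) e Φ.hom.hom.hom he
  have h₁ : complexBetti.map e.inv (2 * k) c ∈ WP s₁ :=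
    map_inv_mem_eigenLines_of_mem_weilClassesOf e (gf s₁) hp0 hX hΦ' he' hc
  -- transport from `s₁`: every value of `σ` lies in the Weil plane of its fibre
  have key : ∀ (s t : Motives.ComplexPoints S) (hst : (σ s).pt = t), (σ s).clsAt hst ∈ WP t := by
    intro s t hst
    obtain rfl : s = t := (hpt s).symm.trans hst
    let γ : Path (⟨s₁, Set.mem_univ s₁⟩ : (Set.univ : Set (Motives.ComplexPoints S)))
        ⟨s, Set.mem_univ s⟩ :=
      (PathConnectedSpace.somePath s₁ s).map (continuous_id.subtype_mk _)
    have htr := transportFun_clsAt_of_continuous f (2 * k) hU hσ hpt γ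
    have h0 : (σ s₁).clsAt (hpt s₁) = complexBetti.map e.inv (2 * k) c := by
      rw [FiberClass.clsAt_eq_iff]; exact hσ₁
    change transportFun f (2 * k) hU ⟦γ⟧ ((σ s₁).clsAt (hpt s₁)) = (σ s).clsAt (hpt s) at htr
    rw [← htr, h0]
    exact transportFun_mem_eigenLines f hU g hg gf hgf ⟦γ⟧ _ _ (2 * k) h₁
  refine ⟨𝒳, S, f, s₁, s₀, e, σ, hfam, hemb, hirr, hsm, hSqp, fun s ↦ ?_, hσ, hpt, fun s ↦ ?_, hσ₁,
    Y, Ψ, e₀, (σ s₀).clsAt (hpt s₀), halg, (FiberClass.mk_clsAt _ _).symm, ?_⟩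
  · -- every fibre is an abelian `2k`-fold with `√-p`
    obtain ⟨A', φ', e', hA', hφ', -, -⟩ := hfib s
    exact ⟨A', φ', hA', hφ', ⟨e'⟩⟩
  · -- the values of `σ` are of Hodge type `(k,k)`: read in the chart of clause (a)
    obtain ⟨A', φ', e', hA', hφ', he'c, hbal⟩ := hfib (σ s).pt
    have hmem : (σ s).cls ∈ WP (σ s).pt := key s (σ s).pt rfl
    have he'' : e'.hom ≫ gf (σ s).pt = φ'.hom.hom.hom ≫ e'.hom :=
      hom_comp_fiberHom_eq_of_comp_fiberι f g (hgf _) e' φ'.hom.hom.hom he'c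
    have hA'mem : complexBetti.map e'.hom (2 * k) (σ s).cls ∈ weilClassesOf A' φ' k p :=
      map_mem_weilClassesOf_of_mem_eigenLines e' (gf _) he'' hmem
    have htyp := (hbal _ hA'mem).map_of_iso e'.symm
    have hid : singularCohomology.map ℂ ℂ (Motives.AlgPoints.mapContinuous (L := ℂ) e'.symm.hom) (2 * k)
        (complexBetti.map e'.hom (2 * k) (σ s).cls) = (σ s).cls := by
      change complexBetti.map e'.inv (2 * k) (complexBetti.map e'.hom (2 * k) (σ s).cls) = _
      rw [← ModuleCat.comp_apply, ← complexBetti.map_comp, e'.inv_hom_id, complexBetti.map_id]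
      rfl
    rw [hid] at htyp
    exact htyp
  · -- at `s₀`: the value lies in the strong Weil plane of `(Y, Ψ)`
    have he₀' : e₀.hom ≫ gf s₀ = Ψ.hom.hom.hom ≫ e₀.hom :=
      hom_comp_fiberHom_eq_of_comp_fiberι f g (hgf s₀) e₀ Ψ.hom.hom.hom he₀
    exact map_mem_weilClassesOf_of_mem_eigenLines e₀ (gf s₀) he₀' (key s₀ s₀ (hpt s₀))

/-- **The charts suffice (algebraic-anchor form)** — the proof of
`deligne1982_weilFamily_globalAction_of_kAction` verbatim: clause (a), balanced Weil type of every
fibre, holds at `s₁` by Deligne's Prop. 4.4 applied to `c`, propagates along paths of the connected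
base (`finrank_eigenspace_inf_hodgeOneZero_eq_of_path'`), and gives the Hodge type `(k,k)` of all
Weil classes of `(A'_s, φ'_s)` by Prop. 4.4 again; the `s₀`-clause is carried along unopened.
[cite: Deligne1982HodgeCycles, proof of Thm. 4.8 (pp. 48–51) with Prop. 4.4]
[cite: vanGeemen1994HodgeAV, Lemma 5.2 (4)] -/
theorem globalActionAlg_of_kActionAlg :
    (∀ p : ℕ, p.Prime → p % 4 = 3 → 7 ≤ p → ∀ (k : ℕ), 1 ≤ k → ∀ (X : AbelianVariety ℂ) (Φ : X ⟶ X), X.dim = 2 * k → Φ ≫ Φ = -((p : ℤ) • 𝟙 X) → ∀ c : complexBetti X.X (2 * k), c ∈ weilClassesOf X Φ k p → c ≠ 0 → IsRationalClass c → IsOfHodgeType (2 * k) X.X (2 * k) k k c → ∃ (𝒳 S : SchemeOver ℂ) (f : 𝒳 ⟶ S) (g : 𝒳 ⟶ 𝒳) (s₁ s₀ : ComplexPoints S) (e : X.X ≅ fiberOver f s₁) (σ : ComplexPoints S → FiberClass f (2 * k)), IsSmoothProjectiveFamily f (2 * k) ∧ (∃ (N : ℕ) (ι : 𝒳 ⟶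 projectiveSpace N ℂ ⊗ S), IsClosedImmersion ι.left ∧ ι ≫ snd (projectiveSpace N ℂ) S = f) ∧ IrreducibleSpace S.left ∧ AlgebraicGeometry.Smooth S.hom ∧ IsQuasiProjectiveOver S ∧ g ≫ f = f ∧ (∀ s : ComplexPoints S, ∃ (A' : AbelianVariety ℂ) (φ' : A' ⟶ A') (e' : A'.X ≅ fiberOver f s), A'.dim = 2 * k ∧ φ' ≫ φ' = -((p : ℤ) • 𝟙 A') ∧ (e'.hom ≫ fiberι f s) ≫ g = φ'.hom.hom.hom ≫ (e'.hom ≫ fiberι f s)) ∧ (e.hom ≫ fiberι f s₁) ≫ g = Φ.hom.hom.hom ≫ (e.hom ≫ fiberι f s₁) ∧ Continuous σ ∧ (∀ s, (σ s).pt = s) ∧ σ s₁ = ⟨s₁, complexBetti.map e.inv (2 * k) c⟩ ∧ ∃ (Y : AbelianVariety ℂ) (Ψ : Y ⟶ Y) (e₀ : Y.X ≅ fiberOver f s₀), weilClassesOf Y Ψ k p ≤ algebraicClasses Y.X k ∧ (e₀.hom ≫ fiberι f s₀) ≫ g = Ψ.hom.hom.hom ≫ (e₀.hom ≫ fiberι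 f s₀)) →
    (∀ p : ℕ, p.Prime → p % 4 = 3 → 7 ≤ p → ∀ (k : ℕ), 1 ≤ k → ∀ (X : AbelianVariety ℂ) (Φ : X ⟶ X), X.dim = 2 * k → Φ ≫ Φ = -((p : ℤ) • 𝟙 X) → ∀ c : complexBetti X.X (2 * k), c ∈ weilClassesOf X Φ k p → c ≠ 0 → IsRationalClass c → IsOfHodgeType (2 * k) X.X (2 * k) k k c → ∃ (𝒳 S : SchemeOver ℂ) (f : 𝒳 ⟶ S) (g : 𝒳 ⟶ 𝒳) (s₁ s₀ : ComplexPoints S) (e : X.X ≅ fiberOver f s₁) (σ : ComplexPoints S → FiberClass f (2 * k)), IsSmoothProjectiveFamily f (2 * k) ∧ (∃ (N : ℕ) (ι : 𝒳 ⟶ projectiveSpace N ℂ ⊗ S), IsClosedImmersion ι.left ∧ ι ≫ snd (projectiveSpace N ℂ) S = f) ∧ IrreducibleSpace S.left ∧ AlgebraicGeometry.Smooth S.hom ∧ IsQuasiProjectiveOver S ∧ g ≫ f = f ∧ (∀ s : ComplexPoints S, ∃ (A' : AbelianVariety ℂ) (φ' : A' ⟶ A') (e' : A'.X ≅ fiberOver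 f s), A'.dim = 2 * k ∧ φ' ≫ φ' = -((p : ℤ) • 𝟙 A') ∧ (e'.hom ≫ fiberι f s) ≫ g = φ'.hom.hom.hom ≫ (e'.hom ≫ fiberι f s) ∧ ∀ w ∈ weilClassesOf A' φ' k p, IsOfHodgeType (2 * k) A'.X (2 * k) k k w) ∧ (e.hom ≫ fiberι f s₁) ≫ g = Φ.hom.hom.hom ≫ (e.hom ≫ fiberι f s₁) ∧ Continuous σ ∧ (∀ s, (σ s).pt = s) ∧ σ s₁ = ⟨s₁, complexBetti.map e.inv (2 * k) c⟩ ∧ ∃ (Y : AbelianVariety ℂ) (Ψ : Y ⟶ Y) (e₀ : Y.X ≅ fiberOver f s₀), weilClassesOf Y Ψ k p ≤ algebraicClasses Y.X k ∧ (e₀.hom ≫ fiberι f s₀) ≫ g = Ψ.hom.hom.hom ≫ (e₀.hom ≫ fiberι f s₀)) := by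
  intro h p hp hp4 hp7 k hk X Φ hX hΦ c hc hc0 hrat hH
  obtain ⟨𝒳, S, f, g, s₁, s₀, e, σ, hfam, hemb, hirr, hsm, hSqp, hg, hfib, he, hσ, hpt, hσ₁, Y, Ψ,
    e₀, halg, he₀⟩ := h p hp hp4 hp7 k hk X Φ hX hΦ c hc hc0 hrat hH
  refine ⟨𝒳, S, f, g, s₁, s₀, e, σ, hfam, hemb, hirr, hsm, hSqp, hg, fun s ↦ ?_, he, hσ, hpt, hσ₁, Y,
    Ψ, e₀, halg, he₀⟩
  have hp0 : 0 < p := hp.pos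
  -- the base: `S(ℂ)` is a path-connected manifold and `R• f_* ℂ` is a local system on it
  haveI := hsm
  haveI := hirr
  haveI : LocallyOfFiniteType S.hom := hSqp.locallyOfFiniteType
  haveI : ConnectedSpace (Motives.ComplexPoints S) :=
    (Motives.ComplexPoints.connectedSpace_iff_holds S).2 inferInstance
  obtain ⟨dS, hdS⟩ := exists_smoothOfRelativeDimension_of_connectedSpace_complexPoints S
  haveI := hdS
  haveI := pathConnectedSpace_complexPoints_of_smoothOfRelativeDimension S dS
  have hU := isCohomologicallyLocallyTrivialOn_univ_of_isSmoothProjectiveFamily f dS hfam hSqp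
  -- the fibre maps of `g`, the fibres, their common projective space
  have hgf' := fun t ↦ exists_fiberHom_comp_fiberι f g hg t
  choose gf hgf using hgf'
  have hsp : ∀ t : Motives.ComplexPoints S, Motives.IsSmoothProjective (2 * k) (Motives.fiberOver f t) :=
    fun t ↦ hfam.isSmoothProjective t
  obtain ⟨m, ε, hε⟩ := exists_forall_isClosedImmersion_fiberι_comp f hfam hemb hSqp
  -- balancedness at `s₁`, read through the chart `e`
  have hΦ' : Φ ≫ Φ = -(p • 𝟙 X) := by rw [hΦ, natCast_zsmul]
  have he' : e.hom ≫ gf s₁ = Φ.hom.hom.hom ≫ e.hom :=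
    hom_comp_fiberHom_eq_of_comp_fiberι f g (hgf s₁) e Φ.hom.hom.hom he
  set μ : ℂ := Complex.I * (Real.sqrt p : ℂ) with hμ
  have hE₁ : Module.finrank ℂ ↥(Module.End.eigenspace (complexBetti.map (gf s₁) 1).hom μ) = 2 * k := by
    rw [finrank_eigenspace_eq_of_iso e (gf s₁) he' μ 1]
    have h2 := two_mul_finrank_eigenspace_eq hp0 hΦ'
    rw [Motives.AbelianVariety.finrank_complexBetti_one, hX, ← hμ] at h2
    omega
  have hbal₁ : Module.finrank ℂ ↥(Module.End.eigenspace (complexBetti.map (gf s₁) 1).hom μ ⊓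
      hodgeOneZero (hsp s₁)) = k := by
    rw [finrank_eigenspace_inf_hodgeOneZero_eq_of_iso hX (hsp s₁) e (gf s₁) he' μ]
    exact finrank_eq_of_mem_weilClassesOf hk hX hp0 hΦ' hc hc0 hH
  -- the chart at `s` and the propagated balancedness
  obtain ⟨A', φ', e', hA', hφ', he'c⟩ := hfib s
  refine ⟨A', φ', e', hA', hφ', he'c, fun w hw ↦ ?_⟩
  have hφ'' : φ' ≫ φ' = -(p • 𝟙 A') := by rw [hφ', natCast_zsmul]
  have he'' : e'.hom ≫ gf s = φ'.hom.hom.hom ≫ e'.hom :=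
    hom_comp_fiberHom_eq_of_comp_fiberι f g (hgf s) e' φ'.hom.hom.hom he'c
  let γ : Path (⟨s₁, Set.mem_univ s₁⟩ : (Set.univ : Set (Motives.ComplexPoints S))) ⟨s, Set.mem_univ s⟩ :=
    (PathConnectedSpace.somePath s₁ s).map (continuous_id.subtype_mk _)
  have hbal : Module.finrank ℂ ↥(Module.End.eigenspace (complexBetti.map φ'.hom.hom.hom 1).hom μ ⊓
      hodgeOneZero (Motives.isSmoothProjective_of_dim_eq' hA')) = k := by
    rw [← finrank_eigenspace_inf_hodgeOneZero_eq_of_iso hA' (hsp s) e' (gf s) he'' μ]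
    exact finrank_eigenspace_inf_hodgeOneZero_eq_of_path' f (by omega) hsp hU g hg gf hgf μ ε hε ⟦γ⟧
      hE₁ hbal₁
  exact isOfHodgeType_of_mem_weilClassesOf hk hA' hp0 hφ'' hbal hw

/-- **`HeckePrymAnchors` from Deligne's abelian scheme with `K`-action in ALGEBRAIC-ANCHOR form.**
The crux follows from the charts-only family package through `X` (family embedded in `ℙᴺ × S` over
a smooth irreducible quasi-projective base, global `√-p` with fibre charts, a continuous section of
`FiberClass f (2k)` through `e^{-1 *} c`) whose special fibre `(Y, Ψ) ≅ 𝒳_{s₀}` has an ALGEBRAIC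
strong Weil plane — instead of being `K`-isogenous to a tensor point. Composition of
`globalActionAlg_of_kActionAlg`, `hodgeWeilSectionAlg_of_globalActionAlg` and
`heckePrymAnchors_of_sections_alg`, the W-engine discharged by the tree's theorem
`deligne1968_invariantClass_fromTotalSpace_holds` through `stub_globalClassOfSection_of_leray`.
[cite: Deligne1982HodgeCycles, proof of Thm. 4.8 (pp. 47–52) with Prop. 4.4]
[cite: VoisinHodgeII2003, Thm. 4.18 (with Thm. 4.15, Lemma 4.17)] -/
theorem heckePrymAnchors_of_kActionAlg :
    (∀ p : ℕ, p.Prime → p % 4 = 3 → 7 ≤ p → ∀ (k : ℕ), 1 ≤ k → ∀ (X : AbelianVariety ℂ) (Φ : X ⟶ X), X.dim = 2 * k → Φ ≫ Φ = -((p : ℤ) • 𝟙 X) → ∀ c : complexBetti X.X (2 * k), c ∈ weilClassesOf X Φ k p → c ≠ 0 → IsRationalClass c → IsOfHodgeType (2 * k) X.X (2 * k) k k c → ∃ (𝒳 S : SchemeOver ℂ) (f : 𝒳 ⟶ S) (g : 𝒳 ⟶ 𝒳) (s₁ s₀ : ComplexPoints S) (e : X.X ≅ fiberOver f s₁) (σ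 : ComplexPoints S → FiberClass f (2 * k)), IsSmoothProjectiveFamily f (2 * k) ∧ (∃ (N : ℕ) (ι : 𝒳 ⟶ projectiveSpace N ℂ ⊗ S), IsClosedImmersion ι.left ∧ ι ≫ snd (projectiveSpace N ℂ) S = f) ∧ IrreducibleSpace S.left ∧ AlgebraicGeometry.Smooth S.hom ∧ IsQuasiProjectiveOver S ∧ g ≫ f = f ∧ (∀ s : ComplexPoints S, ∃ (A' : AbelianVariety ℂ) (φ' : A' ⟶ A') (e' : A'.X ≅ fiberOver f s), A'.dim = 2 * k ∧ φ' ≫ φ' = -((p : ℤ) • 𝟙 A') ∧ (e'.hom ≫ fiberι f s) ≫ g = φ'.hom.hom.hom ≫ (e'.hom ≫ fiberι f s)) ∧ (e.hom ≫ fiberι f s₁) ≫ g = Φ.hom.hom.hom ≫ (e.hom ≫ fiberι f s₁) ∧ Continuous σ ∧ (∀ s, (σ s).pt = s) ∧ σ s₁ = ⟨s₁, complexBetti.map e.inv (2 * k) c⟩ ∧ ∃ (Y : AbelianVariety ℂ) (Ψ : Y ⟶ Y) (e₀ : Y.X ≅ fiberOver f s₀), weilClassesOf Y Ψ k p ≤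 algebraicClasses Y.X k ∧ (e₀.hom ≫ fiberι f s₀) ≫ g = Ψ.hom.hom.hom ≫ (e₀.hom ≫ fiberι f s₀)) → Summit.HodgeConjecture.HodgeConjecture.Theses.HeckePrymWeil.HeckePrymAnchors :=
  fun h =>
    heckePrymAnchors_of_sections_alg
      (stub_globalClassOfSection_of_leray deligne1968_invariantClass_fromTotalSpace_holds)
      (hodgeWeilSectionAlg_of_globalActionAlg (globalActionAlg_of_kActionAlg h))

end Summit.HodgeConjecture.HodgeConjecture.Theorems.HeckePrymWeilLine

end
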